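import Summits.BirchSwinnertonDyer.BirchSwinnertonDyer.Theorems.KimAtThreeDeepUpperExpStarTowerRange
import Summits.BirchSwinnertonDyer.BirchSwinnertonDyer.Theorems.KimAtThreeDeepUpperExpStarUnit
import Summits.BirchSwinnertonDyer.BirchSwinnertonDyer.Theorems.KimAtThreeDeepUpperFactorFieldNorm
import Summits.BirchSwinnertonDyer.BirchSwinnertonDyer.Theorems.KimAtThreeSemiLocalTraceDualLocal
import Summits.BirchSwinnertonDyer.BirchSwinnertonDyer.Theorems.KimAtThreeFineKatoPerFactorPlaces
import Summits.BirchSwinnertonDyer.Rank1Residual.GaloisImage.CyclotomicTameLevelArithmetic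
import HarnessLib

/-!
# hLatᵘ DISCHARGED: the per-factor lattice bound `p³ · exp*_{d_w}(H¹(L_w, T_pW)) ⊆ 𝒪_w` at EVERY place `w ∣ p` of
# every `ℚ(ζ_m)` (ramified or not), for every (RES_w)-compatible line datum over an `hdual`-normalised Néron line
# (route `KimAtThreeKolyvagin`, rung W2, item 20013 / cruxes 19075 · 19076; cell `bsd-addord`, seat w2-c3 gen 8)

HONEST FRAMING. Theorems only (local instances on `ℚ_v` exactly as in `KimAtThreeDeepUpperExpStarFacts`, plus the
`Fact (p ∈ v_p)` key as a local instance); nothing is closed or booked; BSD is not proved by any of this. CONDITIONAL on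
ONE Literature cite fact, displayed: (S5b-tower) `PAdicHodge.exists_smul_range_expStarCoord_tower_iff_trace_log`
(`DualExpEllipticTower.lean`, p511026: Kato II Thm. 1.4.1 (3)–(4) + BK90 §3 at two levels of a tower, ONE differential).

WHAT. w2-c2 g9 (`KimAtThreeDeepLowerKatoParts`, p512822) proved `definedKatoUniformThree_of_katoParts :
(S5a) → hKatoV2ᵘ → hLatᵘ → DefinedKatoUniformThree` — the registered support item 20013 (the W2 deep leaf's one
displayed residual, behind 19075 / 19679 / 19076 / 19562 / `N11.KimAtThreeDeepPUB`) BY NAME from the Kato-v2 typer's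
statement hKatoV2ᵘ and a displayed per-factor lattice bound **hLatᵘ**: for every curve, every `hdual`-normalised local
Néron line `d` at `v₃`, ONE exponent `b₀` with `3^{b₀} · exp*_{d_{w₀}}(H¹(L_{w₀}, T₃W)) ⊆ 𝒪_{w₀}` at EVERY tame-type level
`m = cycLevel 3 0 r` and EVERY place `w₀ ∣ 3` of `ℚ(ζ_m)` — including the RAMIFIED ones (`3 ∣ m`) — for every line datum
`d_{w₀}` with (RES₀). THIS FILE PROVES hLatᵘ (with `b₀ = 3`) from (S5b-tower):

* `pow_three_mul_expStarOmegaHom_mem_of_facts` (generic `p`): **`p³ · exp*_{dw}(z) ∈ 𝒪_{w₀}`**. Chain — (1) (S5b-tower)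
  instantiated in class currency (`KimAtThreeDeepUpperExpStarTowerRange.exists_smul_ranges_of_facts`): ONE `e ∈ ℚ_vˣ` with
  `hdual(e • d)` and `range(exp*_{e•dw}) = {a : ∀ P′, ‖Tr_{L_{w₀}/ℚ_p}(a · log_ω P′)‖ ≤ 1}` for the compatible valuation
  `ν` = the base-`p^{1/e}` norm of the synonym `Kwe` (`KimAtThreeDeepUpperFactorFieldNorm.Kwe.compatible_normValuation`;
  integrality by kport's `isIntegral_baseChange_of_isGloballyMinimal`); (2) the UNIT STEP, stratum-free
  (`KimAtThreeDeepUpperExpStarUnit.mem_integers_of_hdual_smul`: `hdual(d) ∧ hdual(e•d) ⇒ e ∈ 𝒪_vˣ`, because `log_ω` is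
  bounded and non-zero on `E(ℚ_p)`); (3) the POINTS SIDE at `L_{w₀}` for ANY ramification
  (`KimAtThreeDeepUpperFactorFieldNorm.exists_point_padicLogPointFiniteExt_eq_sq_mul`: `p² 𝒪_{w₀} ⊆ log_ω E(L_{w₀})`, x1b's
  `BallEval.exists_ptLog_eq` on the synonym normed so that `‖p‖ = p⁻¹`, read through kport's (J4a)/(J4b)), whence
  `Tr_{L_{w₀}/ℚ_v}(p² a · o) ∈ 𝒪_v` for all `o ∈ 𝒪_{w₀}` (`Kw.trace_adicCompletionPadicAlgebra_eq`, `e_p(ℤ_p) = 𝒪_v`);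
  (4) w2-acc3's inverse-different bound `pow_padicValNat_mul_mem_adicCompletionIntegers_of_forall_trace_mul_mem`
  (`p^{v_p(m)} 𝒪_{w₀}^∨ ⊆ 𝒪_{w₀}`) and `v_p(m) ≤ 1` (`padicValNat_cycLevel_zero_le_one`) give `p³ a ∈ 𝒪_{w₀}`;
  (5) `exp*_{dw} = e · exp*_{e•dw}` (`expStarOmega_smul`) with `e ∈ 𝒪_v ↦ 𝒪_{w₀}`.
* `hLat_of_facts` — **hLatᵘ VERBATIM** (w2-c2's binder text, `p = 3`, `∃ b₀ := 3`).

So the W2 deep family's residual of record becomes: leaves ∧ (S5a) [cite] ∧ (S5b-tower) [cite] ∧ hKatoV2ᵘ [the Kato-v2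
typer's statement over the DEFINED `Λ`/`exp*_ω`]; the exp*-side AND the lattice side are discharged.

References: [Kato1993LNM1553] Ch. II §1.2.4, Prop. 1.2.3, Thm. 1.4.1; [BlochKato1990] §3 Prop. 3.8, Ex. 3.11;
[SilvermanAEC2009] IV.6.4, VII.2.2, VII.6.3; [CasselsFrohlichANT1967] Ch. II §10 (10.2); [SerreLocalFields1979] II §1–§5;
[Kato2004Asterisque] Thm. 9.7 / Ex. 13.3 (the consumer's context).
-/

set_option autoImplicit false
-- the Theorems namespace of a single-conjunct summit repeats the summit name by design (D-0017)
set_option linter.dupNamespace false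

noncomputable section

open scoped NumberField NNReal Classical
open Field ValuativeRel IsDedekindDomain NumberField
open Literature.NumberTheory.GaloisRepresentations
open Literature.NumberTheory.GaloisRepresentations.PeriodRingData
open Literature.NumberTheory.PAdicHodge
open Literature.NumberTheory.EllipticCurves WeierstrassCurve
open Literature.NumberTheory.EllipticCurves.FormalGroupChart (padicLogPointFiniteExt)
open Literature.NumberTheory.EllipticCurves.Kato2004.EulerSystemValues (cycLevel)
open Literature.NumberTheory.AdelicBaseChange
open Summit.BirchSwinnertonDyer.BirchSwinnertonDyer.Theorems.KimAtThreeDeepLowerExpStarOmega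
open Summit.BirchSwinnertonDyer.BirchSwinnertonDyer.Theorems.KimAtThreeDeepLowerExpStarOmegaPlace
open Summit.BirchSwinnertonDyer.BirchSwinnertonDyer.Theorems.KimAtThreeDeepUpperExpStarTowerRange
open Summit.BirchSwinnertonDyer.BirchSwinnertonDyer.Theorems.KimAtThreeDeepUpperExpStarUnit
open Summit.BirchSwinnertonDyer.BirchSwinnertonDyer.Theorems.KimAtThreeDeepUpperFactorFieldNorm
open Summit.BirchSwinnertonDyer.BirchSwinnertonDyer.Theorems.KimAtThreeSemiLocalTraceDualLocal
open Summit.BirchSwinnertonDyer.BirchSwinnertonDyer.Theorems.KimAtThreePortSharedSATCore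
  (exists_padicInt_coe_eq_of_norm_le_one)
open Summit.BirchSwinnertonDyer.BirchSwinnertonDyer.Theorems.KimAtThreeFineKatoPerFactorPlaces
  (three_mem_asIdeal_extension)
open Summit.BirchSwinnertonDyer.BirchSwinnertonDyer.Theorems.KPort
open Summit.BirchSwinnertonDyer.Rank1Residual.GaloisImage
open Summit.BirchSwinnertonDyer.Rank1Residual.GaloisImage.TameLevel (squarefree_cycLevel_zero)
open Summit.BirchSwinnertonDyer.Rank1Residual.Additive.LocalLog (padicLog)
open Rat.HeightOneSpectrum

namespace Summit.BirchSwinnertonDyer.BirchSwinnertonDyer.Theorems.KimAtThreeDeepUpperTowerLattice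

variable (p : ℕ) [hp : Fact p.Prime]

/-- `v_p(m) ≤ 1` for the squarefree tame-type level `m = cycLevel p 0 r = ∏_{q ∈ r} ℓ_q`. [folklore] -/
theorem padicValNat_cycLevel_zero_le_one (r : Finset (HeightOneSpectrum (𝓞 ℚ))) :
    padicValNat p (cycLevel p 0 r) ≤ 1 := by
  rw [← Nat.factorization_def _ hp.out]
  exact (squarefree_cycLevel_zero p r).natFactorization_le_one p

/-- `p ∈ v_p` for `v_p = primesEquiv.symm p`, as a `Fact` (keys the local structures on `ℚ_{v_p}`). [folklore] -/
theorem fact_natCast_mem_primesEquiv_symm :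
    Fact (((p : ℕ) : 𝓞 ℚ) ∈ ((primesEquiv (R := 𝓞 ℚ)).symm ⟨p, hp.out⟩).asIdeal) :=
  ⟨(natCast_mem_asIdeal_iff_eq_primesEquiv_symm _ hp.out).mpr rfl⟩

attribute [local instance] fact_natCast_mem_primesEquiv_symm
-- the tree's `ℚ`-algebra structure on `ℚ_v` first (see `KimAtThreeDeepUpperExpStarFacts`)
attribute [local instance 100000] NumberField.Place.instAlgebraCompletion
attribute [local instance] valuativeRelPlace topologicalSpacePlace
attribute [local instance] isNonarchimedeanLocalField_place charZero_place
attribute [local instance] padicAlgebraPlace fact_not_isUnit_place isAdicComplete_place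

/-- `‖e_p⁻¹ t‖ ≤ 1 ⇒ t ∈ 𝒪_v` (`e_p = Padic.adicCompletionEquiv` identifies `ℤ_p` with `𝒪_v`). [folklore] -/
theorem mem_adicCompletionIntegers_of_norm_symm_le_one
    (t : (((primesEquiv (R := 𝓞 ℚ)).symm ⟨p, hp.out⟩).adicCompletion ℚ))
    (ht : ‖(Padic.adicCompletionEquiv (𝓞 ℚ) ⟨p, hp.out⟩).symm t‖ ≤ 1) :
    t ∈ ((primesEquiv (R := 𝓞 ℚ)).symm ⟨p, hp.out⟩).adicCompletionIntegers ℚ := by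
  obtain ⟨s, hs⟩ := exists_padicInt_coe_eq_of_norm_le_one (p := p) ht
  have h : t = (Padic.adicCompletionEquiv (𝓞 ℚ) ⟨p, hp.out⟩) (s : ℚ_[p]) := by
    rw [hs]; exact ((Padic.adicCompletionEquiv (𝓞 ℚ) ⟨p, hp.out⟩).apply_symm_apply t).symm
  rw [h, ← PadicInt.coe_adicCompletionIntegersEquiv_apply]
  exact (PadicInt.adicCompletionIntegersEquiv (𝓞 ℚ) ⟨p, hp.out⟩ s).2

set_option backward.isDefEq.respectTransparency false in
set_option maxHeartbeats 800000 in
/-- **The per-factor lattice bound, all places, exponent `3`** (generic `p`). For `W/ℚ` globally minimal, a local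
Néron line `d` at `v_p` with Prop-1.2.3 binders and `hdual` (read in `ℚ_p` through `e_p⁻¹`), EVERY tame-type level
`m = cycLevel p 0 r`, EVERY place `w₀ ∣ p` of `ℚ(ζ_m)` (any ramification) and every line datum `dw` of the tower
representation at `L_{w₀}` with Prop-1.2.3 binders and (RES_w) `exp*_{dw} ∘ res = (ℚ_v → L_{w₀}) ∘ exp*_d`:
**`p³ · exp*_{dw}(z) ∈ 𝒪_{w₀}` for every `z ∈ H¹(L_{w₀}, T_pW)`.** Chain: (S5b-tower) gives ONE `e` with
`range(exp*_{e•dw}) = (log_ω E(L_{w₀}))^∨` (trace dual) and `hdual(e•d)`; the unit step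
(`mem_integers_of_hdual_smul`, stratum-free) gives `e ∈ 𝒪_v`; the points side on the base-`p^{1/e}` normed synonym
(`exists_point_padicLogPointFiniteExt_eq_sq_mul`: `p²𝒪_{w₀} ⊆ log_ω E(L_{w₀})`, ANY ramification) turns the
trace-dual bound into `Tr_{L_{w₀}/ℚ_v}(p² a · 𝒪_{w₀}) ⊆ 𝒪_v`; w2-acc3's inverse-different bound
(`pow_padicValNat_mul_mem_adicCompletionIntegers_of_forall_trace_mul_mem`) and `v_p(m) ≤ 1` give `p³ a ∈ 𝒪_{w₀}`;
finally `exp*_{dw} = e · exp*_{e•dw}` (`expStarOmega_smul`). CONDITIONAL on the cite fact (S5b-tower) only.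
[cite: Kato1993LNM1553, Ch. II §1.2.4, Thm. 1.4.1 (3)–(4)] [cite: BlochKato1990, §3 Prop. 3.8, Ex. 3.11] [cite: SilvermanAEC2009, Thm. IV.6.4, VII.6.3] [cite: CasselsFrohlichANT1967, Ch. II §10 Theorem (10.2)] -/
theorem pow_three_mul_expStarOmegaHom_mem_of_facts (hT₂ : exists_smul_range_expStarCoord_tower_iff_trace_log)
    (W : WeierstrassCurve ℚ) [W.IsElliptic] [W.IsGloballyMinimal]
    (d : LocalNeronLineAt W p ((primesEquiv (R := 𝓞 ℚ)).symm ⟨p, hp.out⟩))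
    (hinj : (bdRPeriodRingData (valuation_place_lt_one p ((primesEquiv (R := 𝓞 ℚ)).symm ⟨p, hp.out⟩))).CupLogInjective
      (logCyclotomic p) (localRationalTateRep W p (galRestrictPlace ((primesEquiv (R := 𝓞 ℚ)).symm ⟨p, hp.out⟩))))
    (hex : ∀ z : contOneCocycles (localRationalTateRep W p (galRestrictPlace ((primesEquiv (R := 𝓞 ℚ)).symm ⟨p, hp.out⟩))).toTopRep,
      (bdRPeriodRingData (valuation_place_lt_one p ((primesEquiv (R := 𝓞 ℚ)).symm ⟨p, hp.out⟩))).HasDualExp (logCyclotomic p)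
        (localRationalTateRep W p (galRestrictPlace ((primesEquiv (R := 𝓞 ℚ)).symm ⟨p, hp.out⟩))) fun σ => z.1 σ)
    (hdual : ∀ a : ℚ_[p], (∃ y, expStarOmegaPadicAt d hinj hex
        (((Padic.adicCompletionEquiv (𝓞 ℚ) ⟨p, hp.out⟩).symm : (((primesEquiv (R := 𝓞 ℚ)).symm ⟨p, hp.out⟩).adicCompletion ℚ) →+* ℚ_[p])) y = a) ↔
      ∀ Q : (W.baseChange ℚ_[p]).toAffine.Point, ‖a * padicLog (W.baseChange ℚ_[p]) Q‖ ≤ 1)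
    (r : Finset (HeightOneSpectrum (𝓞 ℚ)))
    (w₀ : ((primesEquiv (R := 𝓞 ℚ)).symm ⟨p, hp.out⟩).Extension (𝓞 (CyclotomicField (cycLevel p 0 r) ℚ))) :
    letI := LocalField.charZero_adicCompletion w₀.1
    letI := LocalField.adicCompletionPadicAlgebra w₀.1 p (Kw.prime_mem_asIdeal w₀)
    haveI : Fact (¬ IsUnit ((p : ℕ) : integerC (w₀.1.adicCompletion (CyclotomicField (cycLevel p 0 r) ℚ)))) := ⟨not_isUnit_natCast_integerC (LocalField.valuation_adicCompletion_natCast_lt_one w₀.1 p (Kw.prime_mem_asIdeal w₀))⟩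
    haveI := isAdicComplete_integerC_natCast (LocalField.valuation_adicCompletion_natCast_lt_one w₀.1 p (Kw.prime_mem_asIdeal w₀))
    ∀ (dw : LocalNeronLine W (LocalField.valuation_adicCompletion_natCast_lt_one w₀.1 p (Kw.prime_mem_asIdeal w₀)) ((galRestrictPlace ((primesEquiv (R := 𝓞 ℚ)).symm ⟨p, hp.out⟩)).comp (absGaloisRestrict (((primesEquiv (R := 𝓞 ℚ)).symm ⟨p, hp.out⟩).adicCompletion ℚ) (w₀.1.adicCompletion (CyclotomicField (cycLevel p 0 r) ℚ)))))
      (hinjw : (bdRPeriodRingData (LocalField.valuation_adicCompletion_natCast_lt_one w₀.1 p (Kw.prime_mem_asIdeal w₀))).CupLogInjective (logCyclotomic p) (localRationalTateRep W p ((galRestrictPlace ((primesEquiv (R := 𝓞 ℚ)).symm ⟨p, hp.out⟩)).comp (absGaloisRestrict (((primesEquiv (R := 𝓞 ℚ)).symm ⟨p, hp.out⟩).adicCompletion ℚ) (w₀.1.adicCompletion (CyclotomicField (cycLevel p 0 r) ℚ))))))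
      (hexw : ∀ z : contOneCocycles (localRationalTateRep W p ((galRestrictPlace ((primesEquiv (R := 𝓞 ℚ)).symm ⟨p, hp.out⟩)).comp (absGaloisRestrict (((primesEquiv (R := 𝓞 ℚ)).symm ⟨p, hp.out⟩).adicCompletion ℚ) (w₀.1.adicCompletion (CyclotomicField (cycLevel p 0 r) ℚ))))).toTopRep,
        (bdRPeriodRingData (LocalField.valuation_adicCompletion_natCast_lt_one w₀.1 p (Kw.prime_mem_asIdeal w₀))).HasDualExp (logCyclotomic p) (localRationalTateRep W p ((galRestrictPlace ((primesEquiv (R := 𝓞 ℚ)).symm ⟨p, hp.out⟩)).comp (absGaloisRestrict (((primesEquiv (R := 𝓞 ℚ)).symm ⟨p, hp.out⟩).adicCompletion ℚ) (w₀.1.adicCompletion (CyclotomicField (cycLevel p 0 r) ℚ))))) fun σ => z.1 σ),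
      (∀ h : (tateLocalRep W p (Sum.inr ((primesEquiv (R := 𝓞 ℚ)).symm ⟨p, hp.out⟩))).cohomology 1,
        expStarOmegaHom (LocalField.valuation_adicCompletion_natCast_lt_one w₀.1 p (Kw.prime_mem_asIdeal w₀)) ((galRestrictPlace ((primesEquiv (R := 𝓞 ℚ)).symm ⟨p, hp.out⟩)).comp (absGaloisRestrict (((primesEquiv (R := 𝓞 ℚ)).symm ⟨p, hp.out⟩).adicCompletion ℚ) (w₀.1.adicCompletion (CyclotomicField (cycLevel p 0 r) ℚ)))) dw hinjw hexw
          (ContinuousRep.cohomologyRes (tateLocalRep W p (Sum.inr ((primesEquiv (R := 𝓞 ℚ)).symm ⟨p, hp.out⟩))) (absGaloisRestrict (((primesEquiv (R := 𝓞 ℚ)).symm ⟨p, hp.out⟩).adicCompletion ℚ) (w₀.1.adicCompletion (CyclotomicField (cycLevel p 0 r) ℚ))) 1 h) =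
        algebraMap (((primesEquiv (R := 𝓞 ℚ)).symm ⟨p, hp.out⟩).adicCompletion ℚ) (w₀.1.adicCompletion (CyclotomicField (cycLevel p 0 r) ℚ)) (expStarOmegaAt d h)) →
      ∀ z, ((p : ℕ) : (w₀.1.adicCompletion (CyclotomicField (cycLevel p 0 r) ℚ))) ^ 3 * expStarOmegaHom (LocalField.valuation_adicCompletion_natCast_lt_one w₀.1 p (Kw.prime_mem_asIdeal w₀)) ((galRestrictPlace ((primesEquiv (R := 𝓞 ℚ)).symm ⟨p, hp.out⟩)).comp (absGaloisRestrict (((primesEquiv (R := 𝓞 ℚ)).symm ⟨p, hp.out⟩).adicCompletion ℚ) (w₀.1.adicCompletion (CyclotomicField (cycLevel p 0 r) ℚ)))) dw hinjw hexw z ∈ (w₀.1.adicCompletionIntegers (CyclotomicField (cycLevel p 0 r) ℚ)) := by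
  intro dw hinjw hexw hres z
  letI := LocalField.charZero_adicCompletion w₀.1
  letI := LocalField.adicCompletionPadicAlgebra w₀.1 p (Kw.prime_mem_asIdeal w₀)
  haveI : Fact (¬ IsUnit ((p : ℕ) : integerC (w₀.1.adicCompletion (CyclotomicField (cycLevel p 0 r) ℚ)))) := ⟨not_isUnit_natCast_integerC (LocalField.valuation_adicCompletion_natCast_lt_one w₀.1 p (Kw.prime_mem_asIdeal w₀))⟩
  haveI := isAdicComplete_integerC_natCast (LocalField.valuation_adicCompletion_natCast_lt_one w₀.1 p (Kw.prime_mem_asIdeal w₀))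
  -- `Place.Completion (inr v₀)` is `ℚ_{v₀}` by `rfl`: read the packet's algebra structure on it
  letI instEF : Algebra (NumberField.Place.Completion (K := ℚ) (Sum.inr ((primesEquiv (R := 𝓞 ℚ)).symm ⟨p, hp.out⟩))) (w₀.1.adicCompletion (CyclotomicField (cycLevel p 0 r) ℚ)) :=
    inferInstanceAs (Algebra (((primesEquiv (R := 𝓞 ℚ)).symm ⟨p, hp.out⟩).adicCompletion ℚ) (w₀.1.adicCompletion (CyclotomicField (cycLevel p 0 r) ℚ)))
  -- a compatible `ℝ≥0`-valuation on `L_{w₀}` (the base-`p^{1/e}` norm of the synonym `Kwe`) and integrality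
  haveI hνc := Kwe.compatible_normValuation (p := p) (L := (CyclotomicField (cycLevel p 0 r) ℚ)) (w := w₀)
  haveI : (W.baseChange (w₀.1.adicCompletion (CyclotomicField (cycLevel p 0 r) ℚ))).IsIntegral
      ((NormedField.valuation : Valuation (Kwe p (CyclotomicField (cycLevel p 0 r) ℚ) w₀) ℝ≥0).comap
        (Kwe.toCompletion p (CyclotomicField (cycLevel p 0 r) ℚ) w₀).symm.toRingHom).integer :=
    Kw.isIntegral_baseChange_of_isGloballyMinimal _ W
  -- (S5b-tower): ONE rescaling `e`
  obtain ⟨e, he, hde, hrange⟩ := exists_smul_ranges_of_facts W p ((primesEquiv (R := 𝓞 ℚ)).symm ⟨p, hp.out⟩) (LocalField.valuation_adicCompletion_natCast_lt_one w₀.1 p (Kw.prime_mem_asIdeal w₀)) hT₂ d hinj hex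
    ((NormedField.valuation : Valuation (Kwe p (CyclotomicField (cycLevel p 0 r) ℚ) w₀) ℝ≥0).comap (Kwe.toCompletion p (CyclotomicField (cycLevel p 0 r) ℚ) w₀).symm.toRingHom)
    dw hinjw hexw hres (((Padic.adicCompletionEquiv (𝓞 ℚ) ⟨p, hp.out⟩).symm : (((primesEquiv (R := 𝓞 ℚ)).symm ⟨p, hp.out⟩).adicCompletion ℚ) →+* ℚ_[p]))
  -- the unit step: `e ∈ 𝒪_v`
  obtain ⟨heO, -⟩ := mem_integers_of_hdual_smul W p ((primesEquiv (R := 𝓞 ℚ)).symm ⟨p, hp.out⟩) d hinj hex _ hdual he hde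
  have hE0 : algebraMap (((primesEquiv (R := 𝓞 ℚ)).symm ⟨p, hp.out⟩).adicCompletion ℚ) (w₀.1.adicCompletion (CyclotomicField (cycLevel p 0 r) ℚ)) e ≠ 0 := (map_ne_zero _).mpr he
  have hEO : algebraMap (((primesEquiv (R := 𝓞 ℚ)).symm ⟨p, hp.out⟩).adicCompletion ℚ) (w₀.1.adicCompletion (CyclotomicField (cycLevel p 0 r) ℚ)) e ∈ (w₀.1.adicCompletionIntegers (CyclotomicField (cycLevel p 0 r) ℚ)) :=
    w₀.adicCompletionSemialgHom_image_adicCompletionIntegers ℚ (CyclotomicField (cycLevel p 0 r) ℚ) ⟨e, heO, rfl⟩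
  -- `exp*_{dw} z = E · a'` with `a' := exp*_{E•dw} z` in the trace dual of `log_ω E(L_{w₀})`
  have haa' : expStarOmegaHom (LocalField.valuation_adicCompletion_natCast_lt_one w₀.1 p (Kw.prime_mem_asIdeal w₀)) ((galRestrictPlace ((primesEquiv (R := 𝓞 ℚ)).symm ⟨p, hp.out⟩)).comp (absGaloisRestrict (((primesEquiv (R := 𝓞 ℚ)).symm ⟨p, hp.out⟩).adicCompletion ℚ) (w₀.1.adicCompletion (CyclotomicField (cycLevel p 0 r) ℚ)))) dw hinjw hexw z = algebraMap (((primesEquiv (R := 𝓞 ℚ)).symm ⟨p, hp.out⟩).adicCompletion ℚ) (w₀.1.adicCompletion (CyclotomicField (cycLevel p 0 r) ℚ)) e *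
      expStarOmegaHom (LocalField.valuation_adicCompletion_natCast_lt_one w₀.1 p (Kw.prime_mem_asIdeal w₀)) ((galRestrictPlace ((primesEquiv (R := 𝓞 ℚ)).symm ⟨p, hp.out⟩)).comp (absGaloisRestrict (((primesEquiv (R := 𝓞 ℚ)).symm ⟨p, hp.out⟩).adicCompletion ℚ) (w₀.1.adicCompletion (CyclotomicField (cycLevel p 0 r) ℚ)))) (dw.smul (algebraMap (((primesEquiv (R := 𝓞 ℚ)).symm ⟨p, hp.out⟩).adicCompletion ℚ) (w₀.1.adicCompletion (CyclotomicField (cycLevel p 0 r) ℚ)) e) ((map_ne_zero (algebraMap (((primesEquiv (R := 𝓞 ℚ)).symm ⟨p, hp.out⟩).adicCompletion ℚ) (w₀.1.adicCompletion (CyclotomicField (cycLevel p 0 r) ℚ)))).mpr he))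
        hinjw hexw z := by
    rw [expStarOmegaHom_apply, expStarOmegaHom_apply, expStarOmega_smul, ← mul_assoc, mul_inv_cancel₀ hE0, one_mul]
  have hdual' := (hrange (expStarOmegaHom (LocalField.valuation_adicCompletion_natCast_lt_one w₀.1 p (Kw.prime_mem_asIdeal w₀)) ((galRestrictPlace ((primesEquiv (R := 𝓞 ℚ)).symm ⟨p, hp.out⟩)).comp (absGaloisRestrict (((primesEquiv (R := 𝓞 ℚ)).symm ⟨p, hp.out⟩).adicCompletion ℚ) (w₀.1.adicCompletion (CyclotomicField (cycLevel p 0 r) ℚ))))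
      (dw.smul (algebraMap (((primesEquiv (R := 𝓞 ℚ)).symm ⟨p, hp.out⟩).adicCompletion ℚ) (w₀.1.adicCompletion (CyclotomicField (cycLevel p 0 r) ℚ)) e) ((map_ne_zero (algebraMap (((primesEquiv (R := 𝓞 ℚ)).symm ⟨p, hp.out⟩).adicCompletion ℚ) (w₀.1.adicCompletion (CyclotomicField (cycLevel p 0 r) ℚ)))).mpr he)) hinjw hexw z)).mp ⟨z, rfl⟩
  -- points: `p² 𝒪_{w₀} ⊆ log_ω E(L_{w₀})`, so `Tr(p² a' · o) ∈ 𝒪_v` for every `o ∈ 𝒪_{w₀}`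
  have htr : ∀ o ∈ (w₀.1.adicCompletionIntegers (CyclotomicField (cycLevel p 0 r) ℚ)),
      Algebra.trace (((primesEquiv (R := 𝓞 ℚ)).symm ⟨p, hp.out⟩).adicCompletion ℚ) (w₀.1.adicCompletion (CyclotomicField (cycLevel p 0 r) ℚ)) ((((p : ℕ) : (w₀.1.adicCompletion (CyclotomicField (cycLevel p 0 r) ℚ))) ^ 2 *
        expStarOmegaHom (LocalField.valuation_adicCompletion_natCast_lt_one w₀.1 p (Kw.prime_mem_asIdeal w₀)) ((galRestrictPlace ((primesEquiv (R := 𝓞 ℚ)).symm ⟨p, hp.out⟩)).comp (absGaloisRestrict (((primesEquiv (R := 𝓞 ℚ)).symm ⟨p, hp.out⟩).adicCompletion ℚ) (w₀.1.adicCompletion (CyclotomicField (cycLevel p 0 r) ℚ)))) (dw.smul (algebraMap (((primesEquiv (R := 𝓞 ℚ)).symm ⟨p, hp.out⟩).adicCompletion ℚ) (w₀.1.adicCompletion (CyclotomicField (cycLevel p 0 r) ℚ)) e) ((map_ne_zero (algebraMap (((primesEquiv (R := 𝓞 ℚ)).symm ⟨p, hp.out⟩).adicCompletion ℚ) (w₀.1.adicCompletion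 (CyclotomicField (cycLevel p 0 r) ℚ)))).mpr he))
          hinjw hexw z) * o) ∈ ((primesEquiv (R := 𝓞 ℚ)).symm ⟨p, hp.out⟩).adicCompletionIntegers ℚ := by
    intro o ho
    obtain ⟨P', hP'⟩ := exists_point_padicLogPointFiniteExt_eq_sq_mul (p := p) (L := (CyclotomicField (cycLevel p 0 r) ℚ)) (w := w₀) W
      ((NormedField.valuation : Valuation (Kwe p (CyclotomicField (cycLevel p 0 r) ℚ) w₀) ℝ≥0).comap (Kwe.toCompletion p (CyclotomicField (cycLevel p 0 r) ℚ) w₀).symm.toRingHom) o ho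
    have h1 := hdual' P'
    rw [hP', ← mul_assoc, mul_comm (expStarOmegaHom _ _ _ _ _ _) (((p : ℕ) : (w₀.1.adicCompletion (CyclotomicField (cycLevel p 0 r) ℚ))) ^ 2),
      Kw.trace_adicCompletionPadicAlgebra_eq w₀ (Kw.prime_mem_asIdeal w₀)] at h1
    exact mem_adicCompletionIntegers_of_norm_symm_le_one p _ h1
  -- w2-acc3's inverse-different bound: `p^{v_p(m)} · p² a' ∈ 𝒪_{w₀}`, and `v_p(m) ≤ 1`
  haveI := HeightOneSpectrum.Extension.fintype (𝓞 ℚ) ℚ (CyclotomicField (cycLevel p 0 r) ℚ) (𝓞 (CyclotomicField (cycLevel p 0 r) ℚ)) ((primesEquiv (R := 𝓞 ℚ)).symm ⟨p, hp.out⟩)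
  have hmem := pow_padicValNat_mul_mem_adicCompletionIntegers_of_forall_trace_mul_mem (cycLevel p 0 r) p w₀ _ htr
  have hpO : ((p : ℕ) : (w₀.1.adicCompletion (CyclotomicField (cycLevel p 0 r) ℚ))) ∈ (w₀.1.adicCompletionIntegers (CyclotomicField (cycLevel p 0 r) ℚ)) := natCast_mem _ p
  have h3 : ((p : ℕ) : (w₀.1.adicCompletion (CyclotomicField (cycLevel p 0 r) ℚ))) ^ 3 *
      expStarOmegaHom (LocalField.valuation_adicCompletion_natCast_lt_one w₀.1 p (Kw.prime_mem_asIdeal w₀)) ((galRestrictPlace ((primesEquiv (R := 𝓞 ℚ)).symm ⟨p, hp.out⟩)).comp (absGaloisRestrict (((primesEquiv (R := 𝓞 ℚ)).symm ⟨p, hp.out⟩).adicCompletion ℚ) (w₀.1.adicCompletion (CyclotomicField (cycLevel p 0 r) ℚ)))) (dw.smul (algebraMap (((primesEquiv (R := 𝓞 ℚ)).symm ⟨p, hp.out⟩).adicCompletion ℚ) (w₀.1.adicCompletion (CyclotomicField (cycLevel p 0 r) ℚ)) e) ((map_ne_zero (algebraMap (((primesEquiv (R := 𝓞 ℚ)).symm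 ⟨p, hp.out⟩).adicCompletion ℚ) (w₀.1.adicCompletion (CyclotomicField (cycLevel p 0 r) ℚ)))).mpr he))
        hinjw hexw z ∈ (w₀.1.adicCompletionIntegers (CyclotomicField (cycLevel p 0 r) ℚ)) := by
    rcases Nat.le_one_iff_eq_zero_or_eq_one.mp (padicValNat_cycLevel_zero_le_one p r) with h0 | h1
    · rw [h0, pow_zero, one_mul] at hmem
      have h2 := mul_mem hpO hmem
      rwa [← mul_assoc, ← pow_succ'] at h2
    · rw [h1, pow_one, ← mul_assoc, ← pow_succ'] at hmem
      exact hmem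
  rw [haa', mul_left_comm]
  exact mul_mem hEO h3

/-- **hLatᵘ VERBATIM** — the displayed hypothesis `hLat` of w2-c2 g9's
`KimAtThreeDeepLowerKatoParts.definedKatoUniformThree_of_katoParts` (item 20013 ⟸ (S5a) ∧ hKatoV2ᵘ ∧ hLatᵘ),
DISCHARGED from the cite fact (S5b-tower) with `b₀ := 3` (`pow_three_mul_expStarOmegaHom_mem_of_facts` at `p = 3`;
the unused instance binders of the displayed text are carried). So 20013 — hence 19075 / 19679 / 19076 / 19562 /
`N11.KimAtThreeDeepPUB` BY NAME — now rests on the four leaves, (S5a), (S5b-tower) and hKatoV2ᵘ (the Kato-v2 typer's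
statement over the DEFINED dual exponentials) alone. [cite: Kato1993LNM1553, Ch. II §1.2.4, Thm. 1.4.1 (3)–(4)] [cite: BlochKato1990, §3 Prop. 3.8, Ex. 3.11] [cite: SilvermanAEC2009, Thm. IV.6.4, VII.6.3] [cite: CasselsFrohlichANT1967, Ch. II §10 Theorem (10.2)] -/
theorem hLat_of_facts (hT₂ : exists_smul_range_expStarCoord_tower_iff_trace_log) :
    ∀ (W : WeierstrassCurve ℚ) [W.IsElliptic] [W.IsGloballyMinimal]
        [ContinuousSMul ℤ_[3] (W.tateModule 3)] [Module.Free ℤ_[3] (W.tateModule 3)]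
        [Module.Finite ℤ_[3] (W.tateModule 3)],
          haveI : Fact (((3 : ℕ) : 𝓞 ℚ) ∈ ((Rat.HeightOneSpectrum.primesEquiv (R := 𝓞 ℚ)).symm ⟨3, Fact.out⟩).asIdeal) :=
            ⟨(natCast_mem_asIdeal_iff_eq_primesEquiv_symm _ Nat.prime_three).mpr rfl⟩
          letI := valuativeRelPlace ((Rat.HeightOneSpectrum.primesEquiv (R := 𝓞 ℚ)).symm ⟨3, Fact.out⟩)
          letI := topologicalSpacePlace ((Rat.HeightOneSpectrum.primesEquiv (R := 𝓞 ℚ)).symm ⟨3, Fact.out⟩)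
          haveI := isNonarchimedeanLocalField_place ((Rat.HeightOneSpectrum.primesEquiv (R := 𝓞 ℚ)).symm ⟨3, Fact.out⟩)
          haveI := charZero_place ((Rat.HeightOneSpectrum.primesEquiv (R := 𝓞 ℚ)).symm ⟨3, Fact.out⟩)
          letI := padicAlgebraPlace 3 ((Rat.HeightOneSpectrum.primesEquiv (R := 𝓞 ℚ)).symm ⟨3, Fact.out⟩)
          haveI := fact_not_isUnit_place 3 ((Rat.HeightOneSpectrum.primesEquiv (R := 𝓞 ℚ)).symm ⟨3, Fact.out⟩)
          haveI := isAdicComplete_place 3 ((Rat.HeightOneSpectrum.primesEquiv (R := 𝓞 ℚ)).symm ⟨3, Fact.out⟩)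
          ∀ (d : LocalNeronLineAt W 3 ((Rat.HeightOneSpectrum.primesEquiv (R := 𝓞 ℚ)).symm ⟨3, Fact.out⟩))
            (hinj : (bdRPeriodRingData (valuation_place_lt_one 3 ((Rat.HeightOneSpectrum.primesEquiv (R := 𝓞 ℚ)).symm ⟨3, Fact.out⟩))).CupLogInjective (logCyclotomic 3)
              (localRationalTateRep W 3 (galRestrictPlace ((Rat.HeightOneSpectrum.primesEquiv (R := 𝓞 ℚ)).symm ⟨3, Fact.out⟩))))
            (hex : ∀ z : contOneCocycles (localRationalTateRep W 3 (galRestrictPlace ((Rat.HeightOneSpectrum.primesEquiv (R := 𝓞 ℚ)).symm ⟨3, Fact.out⟩))).toTopRep,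
              (bdRPeriodRingData (valuation_place_lt_one 3 ((Rat.HeightOneSpectrum.primesEquiv (R := 𝓞 ℚ)).symm ⟨3, Fact.out⟩))).HasDualExp (logCyclotomic 3)
                (localRationalTateRep W 3 (galRestrictPlace ((Rat.HeightOneSpectrum.primesEquiv (R := 𝓞 ℚ)).symm ⟨3, Fact.out⟩))) fun σ => z.1 σ),
            (∀ a : ℚ_[3], (∃ y, (expStarOmegaPadicAt d hinj hex (((Padic.adicCompletionEquiv (𝓞 ℚ) ⟨3, Fact.out⟩).symm : (((Rat.HeightOneSpectrum.primesEquiv (R := 𝓞 ℚ)).symm ⟨3, Fact.out⟩).adicCompletion ℚ) →+* ℚ_[3]))) y = a) ↔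
              ∀ Q : (W.baseChange ℚ_[3]).toAffine.Point, ‖a * padicLog (W.baseChange ℚ_[3]) Q‖ ≤ 1) →
            ∃ b₀ : ℕ, ∀ (r : Finset (HeightOneSpectrum (𝓞 ℚ)))
              (w₀ : ((Rat.HeightOneSpectrum.primesEquiv (R := 𝓞 ℚ)).symm ⟨3, Fact.out⟩).Extension
                (𝓞 (CyclotomicField (cycLevel 3 0 r) ℚ))),
              letI := LocalField.charZero_adicCompletion w₀.1
              letI := LocalField.adicCompletionPadicAlgebra w₀.1 3 (three_mem_asIdeal_extension _ w₀)
              haveI : Fact (¬ IsUnit ((3 : ℕ) : integerC (w₀.1.adicCompletion (CyclotomicField (cycLevel 3 0 r) ℚ)))) :=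
                ⟨not_isUnit_natCast_integerC (LocalField.valuation_adicCompletion_natCast_lt_one w₀.1 3 (three_mem_asIdeal_extension _ w₀))⟩
              haveI := isAdicComplete_integerC_natCast (LocalField.valuation_adicCompletion_natCast_lt_one w₀.1 3 (three_mem_asIdeal_extension _ w₀))
              ∀ (dw : LocalNeronLine W (LocalField.valuation_adicCompletion_natCast_lt_one w₀.1 3 (three_mem_asIdeal_extension _ w₀))
                ((galRestrictPlace ((Rat.HeightOneSpectrum.primesEquiv (R := 𝓞 ℚ)).symm ⟨3, Fact.out⟩)).comp
                      (absGaloisRestrict (((Rat.HeightOneSpectrum.primesEquiv (R := 𝓞 ℚ)).symm ⟨3, Fact.out⟩).adicCompletion ℚ) (w₀.1.adicCompletion (CyclotomicField (cycLevel 3 0 r) ℚ)))))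
                (hinjw : (bdRPeriodRingData (LocalField.valuation_adicCompletion_natCast_lt_one w₀.1 3 (three_mem_asIdeal_extension _ w₀))).CupLogInjective
                  (logCyclotomic 3) (localRationalTateRep W 3 ((galRestrictPlace ((Rat.HeightOneSpectrum.primesEquiv (R := 𝓞 ℚ)).symm ⟨3, Fact.out⟩)).comp
                      (absGaloisRestrict (((Rat.HeightOneSpectrum.primesEquiv (R := 𝓞 ℚ)).symm ⟨3, Fact.out⟩).adicCompletion ℚ) (w₀.1.adicCompletion (CyclotomicField (cycLevel 3 0 r) ℚ))))))
                (hexw : ∀ z : contOneCocycles (localRationalTateRep W 3 ((galRestrictPlace ((Rat.HeightOneSpectrum.primesEquiv (R := 𝓞 ℚ)).symm ⟨3, Fact.out⟩)).comp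
                      (absGaloisRestrict (((Rat.HeightOneSpectrum.primesEquiv (R := 𝓞 ℚ)).symm ⟨3, Fact.out⟩).adicCompletion ℚ) (w₀.1.adicCompletion (CyclotomicField (cycLevel 3 0 r) ℚ))))).toTopRep,
                  (bdRPeriodRingData (LocalField.valuation_adicCompletion_natCast_lt_one w₀.1 3 (three_mem_asIdeal_extension _ w₀))).HasDualExp
                    (logCyclotomic 3) (localRationalTateRep W 3 ((galRestrictPlace ((Rat.HeightOneSpectrum.primesEquiv (R := 𝓞 ℚ)).symm ⟨3, Fact.out⟩)).comp
                      (absGaloisRestrict (((Rat.HeightOneSpectrum.primesEquiv (R := 𝓞 ℚ)).symm ⟨3, Fact.out⟩).adicCompletion ℚ) (w₀.1.adicCompletion (CyclotomicField (cycLevel 3 0 r) ℚ))))) fun σ => z.1 σ),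
                (∀ (h : (tateLocalRep W 3 (Sum.inr ((Rat.HeightOneSpectrum.primesEquiv (R := 𝓞 ℚ)).symm ⟨3, Fact.out⟩))).cohomology 1),
                  expStarOmegaHom (LocalField.valuation_adicCompletion_natCast_lt_one w₀.1 3 (three_mem_asIdeal_extension _ w₀))
                      ((galRestrictPlace ((Rat.HeightOneSpectrum.primesEquiv (R := 𝓞 ℚ)).symm ⟨3, Fact.out⟩)).comp
                      (absGaloisRestrict (((Rat.HeightOneSpectrum.primesEquiv (R := 𝓞 ℚ)).symm ⟨3, Fact.out⟩).adicCompletion ℚ) (w₀.1.adicCompletion (CyclotomicField (cycLevel 3 0 r) ℚ)))) dw hinjw hexw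
                    (ContinuousRep.cohomologyRes (tateLocalRep W 3 (Sum.inr ((Rat.HeightOneSpectrum.primesEquiv (R := 𝓞 ℚ)).symm ⟨3, Fact.out⟩)))
                      (absGaloisRestrict (((Rat.HeightOneSpectrum.primesEquiv (R := 𝓞 ℚ)).symm ⟨3, Fact.out⟩).adicCompletion ℚ) (w₀.1.adicCompletion (CyclotomicField (cycLevel 3 0 r) ℚ))) 1 h) =
                  algebraMap (((Rat.HeightOneSpectrum.primesEquiv (R := 𝓞 ℚ)).symm ⟨3, Fact.out⟩).adicCompletion ℚ) (w₀.1.adicCompletion (CyclotomicField (cycLevel 3 0 r) ℚ)) (expStarOmegaAt d h)) →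
                ∀ z, ((3 : ℕ) : w₀.1.adicCompletion (CyclotomicField (cycLevel 3 0 r) ℚ)) ^ b₀ *
                    expStarOmegaHom (LocalField.valuation_adicCompletion_natCast_lt_one w₀.1 3 (three_mem_asIdeal_extension _ w₀))
                      ((galRestrictPlace ((Rat.HeightOneSpectrum.primesEquiv (R := 𝓞 ℚ)).symm ⟨3, Fact.out⟩)).comp
                      (absGaloisRestrict (((Rat.HeightOneSpectrum.primesEquiv (R := 𝓞 ℚ)).symm ⟨3, Fact.out⟩).adicCompletion ℚ) (w₀.1.adicCompletion (CyclotomicField (cycLevel 3 0 r) ℚ)))) dw hinjw hexw z ∈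
                  w₀.1.adicCompletionIntegers (CyclotomicField (cycLevel 3 0 r) ℚ) := by
  intro W _ _ _ _ _ d hinj hex hdual
  exact ⟨3, fun r w₀ => pow_three_mul_expStarOmegaHom_mem_of_facts 3 hT₂ W d hinj hex hdual r w₀⟩

end Summit.BirchSwinnertonDyer.BirchSwinnertonDyer.Theorems.KimAtThreeDeepUpperTowerLattice

end
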